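import Literature.GroupTheory.CentralExtensionDicyclicTransfer
import HarnessLib

/-!
# Central extensions with torsion kernel of exponent `e`: the transfer to a dicyclic subgroup of index prime to `e`,
# and the extension criterion for stable characters (the group theory behind «`M(SL₂(p)) = 1`» at every prime `ℓ ≠ p`)

Topic `GroupTheory`; namespace `Literature.GroupTheory.CentralExtensionDicyclicTorsion`. THEOREMS ONLY (no definition, no named
fact, no `sorry`).  This is the sibling file `CentralExtensionDicyclicTransfer.lean` (namespace `…CentralExtensionDicyclic`,
exponent `2`, `q` odd, `k` even, ODD index) with every `2`-specific hypothesis removed: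

* **(B′)** `pow_index_mem_commutator_subgroup` / `mem_commutator_subgroup_of_coprime_index`: a central `z ∈ [E, E]` with
  `z ^ e = 1` lies in `⁅H, H⁆` for every subgroup `H` of index PRIME TO `e` (transfer `E → H^{ab}`: `z ↦ z^{[E:H]}`; Brown
  III.9 Exercise 2, III.10 (10.1)–(10.3), IV.3 Exercise 4(a));
* **(A′)** `eq_one_of_mem_commutator_closure_dicyclic'`: for a central subgroup `A` (ANY exponent) and `α, β` with the dicyclic
  relations modulo `A` — `βαβ⁻¹α ∈ A`, `β²(α^k)⁻¹ ∈ A`, `α^{2m} ∈ A ⇒ k ∣ m`, with NO parity condition on `k` — the commutator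
  subgroup of `⟨α, β, A⟩` meets `A` trivially.  The computation: with `z₁ = βαβ⁻¹α` (central) one has `⁅α, β⁆ = α² z₁⁻¹ =: c`,
  `αcα⁻¹ = c`, `βcβ⁻¹ = c⁻¹`, so `⁅H, H⁆ = ⟨c⟩`; conjugating `β² = z₂ α^k` by `β` gives `α^{2k} = z₁^k`, hence `c^k = 1`, and
  `c^m ∈ A ⇒ α^{2m} ∈ A ⇒ k ∣ m ⇒ c^m = 1` (this is the central-extension content of «dicyclic groups — and `S₃` — have trivial
  Schur multiplier», Brown VI.9 Exercises 3 and 8; the sibling's proof used `z₁² = 1` and `k` even to get `α^{2k} = 1`, which is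
  not needed);
* **(C′)** `stable_character_eq_zero_of_mem_commutator'` and the **abstract extension criterion**
  `existsUnique_extension_of_stable_of_dicyclic_coprimeIndex`: `Q` generated by elements killed by `q`, containing such a pair
  `(a, b)` with `[Q : ⟨a, b⟩]` prime to `e`; then for every surjection `π : G ↠ Q`, every abelian group `K` with `e • K = 0` on
  which `q` acts invertibly (`(q u) • y = y` — `exists_mul_nsmul_eq_self_of_coprime` produces `u` from `q ⊥ e`), every
  `G`-stable additive `ψ : ker π → K` has a UNIQUE additive extension `Ψ : G → K` (`Ψ(g) = u • ψ(n)` for `g^q = n·c`,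
  `c ∈ [G, G]`); uniqueness `eq_of_mul_add_of_eqOn_ker'`.

WHAT IT SERVES.  With `e = 3`, `Q = SL₂(𝔽_q)` for a prime `q ≠ 3` (generated by transvections, of order `q`), and `(a, b)` = a
generator of the cyclic torus `T = C(w₃)` of an element `w₃` of order `3` together with an element `b ∈ N(T)` inverting it
(`b² = -1 = a^{|T|/2}` for `q` odd — the dicyclic group `Q_{2(q∓1)}`, sign with `3 ∣ q ∓ 1`, of index `q(q±1)/2` prime to `3`;
for `q = 2`, `Q = S₃ = ⟨a, b⟩` itself with `k = 3`), this yields the characteristic-`3` EXT-CRIT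
`Literature.GroupTheory.SpecificGroups.sl2ZModPrime_exists_extension_of_stable_character_charThree` (statement filed
separately; the `SL₂`-specific data are NOT in this file) — i.e. the `3`-part of «`SL₂(p)`, `p` prime, has trivial Schur
multiplier» [Gorenstein 1982, Prop. 4.232 (i), p. 288; the Sylow-`3` subgroups are cyclic and their normalisers dicyclic,
Prop. 4.227/4.230] in the extension form used by the BSD cell `bsd-f2-manin` (es lens, F-es-27‴, MEMO-es §32.4).  No
finiteness of `G`, `K` or `Q` is used (only `[Q : ⟨a, b⟩]` prime to `e`).

## References (locators as in the sibling file, read there first-hand in the held copy `book:brown1982-cohomology-groups`)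

* [Brown1982CohomologyGroups] K. S. Brown, *Cohomology of Groups*, GTM 87: III.9 Exercise 2, III.10 (10.1)–(10.3), IV.3
  Exercise 4(a) (transfer on a central element), VI.9 Exercises 3 and 8 (dicyclic groups, trivial multiplier).
* [Gorenstein1982] D. Gorenstein, *Finite Simple Groups*, Prop. 4.227, 4.230, 4.232 (i), 4.233 (p. 288 of the held copy
  `book:gorenstein1982-finite-simple-groups`): the Schur multiplier of `SL₂(p)` is trivial — the statement whose
  coefficient-wise form (C′) serves.
-/

open Subgroup
open scoped commutatorElement

namespace Literature.GroupTheory.CentralExtensionDicyclicTorsion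

open Literature.GroupTheory.CentralExtensionDicyclic

variable {E : Type*} [Group E]

/-- **(B′) Transfer, any torsion.** A central element `z` of the commutator subgroup of `E`, and a subgroup `H` of finite index:
`z ^ [E:H] ∈ ⁅H, H⁆` (so `z ∈ H` is automatic for the power): the transfer `E → H^{ab}` kills `[E, E]` and sends the central `z` to `z^{[E:H]}`.
[cite: Brown1982CohomologyGroups, III.9 Exercise 2, III.10 (10.1)-(10.3), IV.3 Exercise 4(a) (transfer on a central element)] -/
theorem pow_index_mem_commutator_subgroup {H : Subgroup E} [H.FiniteIndex] {z : E}
    (hzc : z ∈ center E) (hz : z ∈ commutator E) :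
    z ^ H.index ∈ ⁅H, H⁆ := by
  have key : ∀ (k : ℕ) (g₀ : E), g₀⁻¹ * z ^ k * g₀ ∈ H → g₀⁻¹ * z ^ k * g₀ = z ^ k := by
    intro k g₀ _
    have hc : g₀⁻¹ * z ^ k = z ^ k * g₀⁻¹ := mem_center_iff.mp (pow_mem hzc k) g₀⁻¹
    rw [hc, inv_mul_cancel_right]
  have h1 : MonoidHom.transfer (Abelianization.of (G := H)) z = 1 :=
    MonoidHom.mem_ker.mp (Abelianization.commutator_subset_ker _ hz)
  rw [MonoidHom.transfer_eq_pow _ z key] at h1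
  have hmem : (⟨z ^ H.index, MonoidHom.transfer_eq_pow_aux z key⟩ : H) ∈ commutator H := by
    rw [← Abelianization.ker_of]; exact h1
  rw [← map_subtype_commutator]
  exact ⟨⟨z ^ H.index, MonoidHom.transfer_eq_pow_aux z key⟩, hmem, rfl⟩

/-- **(B′) with coprimality.** If moreover `z ^ e = 1` and `[E:H]` is prime to `e`, then `z ∈ ⁅H, H⁆` (`z` is a power of
`z^{[E:H]}`; degenerate cases `e = 1`: `z = 1`, `e = 0`: `H = ⊤`).
[cite: Brown1982CohomologyGroups, III.10 (10.1)-(10.3) (the e-primary part is detected on a subgroup of index prime to e)] -/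
theorem mem_commutator_subgroup_of_coprime_index {H : Subgroup E} {e : ℕ} (hidx : H.index.Coprime e) {z : E}
    (hzc : z ∈ center E) (hze : z ^ e = 1) (hz : z ∈ commutator E) :
    z ∈ ⁅H, H⁆ := by
  rcases Nat.lt_or_ge 1 e with he | he
  · -- `e ≥ 2`: the index is invertible modulo `e`
    have hfin : H.index ≠ 0 := by
      intro h0; rw [h0, Nat.coprime_zero_left] at hidx; omega
    haveI : H.FiniteIndex := ⟨hfin⟩
    obtain ⟨u, -, hu⟩ := Nat.exists_mul_mod_eq_one_of_coprime hidx he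
    have hpow := pow_mem (pow_index_mem_commutator_subgroup (H := H) hzc hz) u
    rw [← pow_mul, ← Nat.div_add_mod (H.index * u) e, hu, pow_add, pow_one, pow_mul, hze, one_pow,
      one_mul] at hpow
    exact hpow
  · -- `e ≤ 1`: then `z = 1` (`e = 1`) or `H = ⊤` (`e = 0` forces index `1`)
    interval_cases e
    · rw [Nat.coprime_zero_right] at hidx
      have hH : H = ⊤ := Subgroup.index_eq_one.mp hidx
      subst hH
      simpa [_root_.commutator_def] using hz
    · rw [pow_one] at hze; rw [hze]; exact one_mem _

/-- **(A′) Dicyclic-by-central, any torsion.** In a group `E` with a central subgroup `A`, let `α β` satisfy the DICYCLIC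
relations modulo `A`: `β α β⁻¹ α ∈ A`, `β² (α^k)⁻¹ ∈ A`, and `α^{2m} ∈ A ⇒ k ∣ m`.  Then the commutator subgroup of
`H = ⟨α, β, A⟩` meets `A` trivially.  (No hypothesis on the exponent of `A` or the parity of `k`: with `z₁ = βαβ⁻¹α` one has
`⁅H, H⁆ = ⟨α² z₁⁻¹⟩`, `α^{2k} = z₁^k`, so `(α² z₁⁻¹)^k = 1`.)
[cite: Brown1982CohomologyGroups, VI.9 Exercise 3 with II.5 Exercise 7(a), VI.9 Exercise 8 (dicyclic groups have trivial Schur multiplier; here in central-extension form, any torsion)] -/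
theorem eq_one_of_mem_commutator_closure_dicyclic' (A : Subgroup E) (hA : A ≤ center E)
    {α β : E} {k : ℕ}
    (h1 : β * α * β⁻¹ * α ∈ A) (h2 : β ^ 2 * (α ^ k)⁻¹ ∈ A)
    (h3 : ∀ m : ℕ, α ^ (2 * m) ∈ A → k ∣ m) {z : E} (hzA : z ∈ A)
    (hz : z ∈ ⁅closure ({α, β} ∪ (A : Set E)), closure ({α, β} ∪ (A : Set E))⁆) : z = 1 := by
  -- notation
  set z₁ : E := β * α * β⁻¹ * α with hz₁
  set T : Set E := {α, β} ∪ (A : Set E) with hT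
  have cen : ∀ a ∈ A, ∀ g : E, Commute g a := fun a ha g => mem_center_iff.mp (hA ha) g
  have hβα : β * α * β⁻¹ = z₁ * α⁻¹ := by rw [hz₁]; group
  have hβα' : β * α⁻¹ * β⁻¹ = α * z₁⁻¹ := by
    have : β * α⁻¹ * β⁻¹ = (β * α * β⁻¹)⁻¹ := by group
    rw [this, hβα, mul_inv_rev, inv_inv]
  set c : E := α ^ 2 * z₁⁻¹ with hc
  have hcomm : Commute (α ^ 2) z₁⁻¹ := cen z₁⁻¹ (inv_mem h1) (α ^ 2)
  -- Step 1: `α ^ (2 * k) = z₁ ^ k`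
  have hαk : α ^ (2 * k) = z₁ ^ k := by
    set z₂ : E := β ^ 2 * (α ^ k)⁻¹ with hz₂
    have hβ2 : β ^ 2 = z₂ * α ^ k := by rw [hz₂]; group
    have e1 : β * β ^ 2 * β⁻¹ = β ^ 2 := by group
    have e2 : β * (z₂ * α ^ k) * β⁻¹ = z₂ * (β * α * β⁻¹) ^ k := by
      rw [conj_pow, ← mul_assoc, (cen z₂ h2 β).eq]
      group
    rw [hβ2] at e1
    rw [e2, hβα, (cen z₁ h1 α⁻¹).symm.mul_pow] at e1
    -- e1 : z₂ * (z₁ ^ k * α⁻¹ ^ k) = z₂ * α ^ k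
    have e3 : z₁ ^ k * α⁻¹ ^ k = α ^ k := mul_left_cancel e1
    rw [inv_pow] at e3
    calc α ^ (2 * k) = α ^ k * α ^ k := by rw [two_mul, pow_add]
      _ = z₁ ^ k * (α ^ k)⁻¹ * α ^ k := by nth_rewrite 1 [← e3]; rfl
      _ = z₁ ^ k := by rw [inv_mul_cancel_right]
  -- Step 2: the commutator subgroup of `H` lies in `zpowers c`
  set L : Subgroup E := zpowers c with hL
  have hconjT : ∀ g ∈ T, g * c * g⁻¹ = c ∨ g * c * g⁻¹ = c⁻¹ := by
    intro g hg
    rcases hg with hg | hg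
    · simp only [Set.mem_insert_iff, Set.mem_singleton_iff] at hg
      rcases hg with hg | hg <;> rw [hg]
      · left
        calc α * c * α⁻¹ = α ^ 2 * (α * z₁⁻¹ * α⁻¹) := by rw [hc]; group
          _ = c := by rw [(cen z₁⁻¹ (inv_mem h1) α).eq, mul_inv_cancel_right]
      · right
        have e1 : β * α ^ 2 * β⁻¹ = z₁ ^ 2 * α⁻¹ ^ 2 := by
          rw [← conj_pow, hβα, (cen z₁ h1 α⁻¹).symm.mul_pow]
        have e2 : β * z₁⁻¹ * β⁻¹ = z₁⁻¹ := by
          rw [(cen z₁⁻¹ (inv_mem h1) β).eq, mul_inv_cancel_right]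
        calc β * c * β⁻¹ = (β * α ^ 2 * β⁻¹) * (β * z₁⁻¹ * β⁻¹) := by rw [hc]; group
          _ = z₁ ^ 2 * (α⁻¹ ^ 2 * z₁⁻¹) := by rw [e1, e2, mul_assoc]
          _ = z₁ ^ 2 * z₁⁻¹ * (α ^ 2)⁻¹ := by
              rw [(cen z₁⁻¹ (inv_mem h1) (α⁻¹ ^ 2)).eq, ← mul_assoc, inv_pow]
          _ = c⁻¹ := by rw [hc]; group
    · left; rw [(cen g hg c).symm.eq, mul_inv_cancel_right]
  have hnormL : ∀ h ∈ closure T, ∀ l ∈ L, h * l * h⁻¹ ∈ L := by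
    intro h hh l hl
    obtain ⟨n, rfl⟩ := mem_zpowers_iff.mp hl
    rw [← conj_zpow]
    rcases conj_eq_or_conj_eq_inv_of_mem_closure hconjT hh with e | e <;> rw [e]
    · exact zpow_mem (mem_zpowers c) n
    · rw [inv_zpow']; exact zpow_mem (mem_zpowers c) (-n)
  have hcomm1 : ∀ a ∈ A, ∀ y : E, ⁅a, y⁆ ∈ L := fun a ha y => by
    rw [((cen a ha y).symm).commutator_eq]; exact one_mem L
  have hcomm2 : ∀ a ∈ A, ∀ x : E, ⁅x, a⁆ ∈ L := fun a ha x => by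
    rw [(cen a ha x).commutator_eq]; exact one_mem L
  have hαβ : ⁅α, β⁆ = c := by
    rw [commutatorElement_def, hc, sq]
    calc α * β * α⁻¹ * β⁻¹ = α * (β * α⁻¹ * β⁻¹) := by group
      _ = α * α * z₁⁻¹ := by rw [hβα', mul_assoc]
  have hgen : ∀ x ∈ T, ∀ y ∈ T, ⁅x, y⁆ ∈ L := by
    intro x hx y hy
    rcases hx with hx | hx
    · rcases hy with hy | hy
      · simp only [Set.mem_insert_iff, Set.mem_singleton_iff] at hx hy
        rcases hx with rfl | rfl <;> rcases hy with rfl | rfl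
        · rw [commutatorElement_self]; exact one_mem L
        · rw [hαβ]; exact mem_zpowers c
        · rw [← commutatorElement_inv, hαβ]; exact inv_mem (mem_zpowers c)
        · rw [commutatorElement_self]; exact one_mem L
      · exact hcomm2 y hy x
    · exact hcomm1 x hx y
  have hgen' : ∀ x ∈ T, ∀ y ∈ closure T, ⁅x, y⁆ ∈ L := by
    intro x hx y hy
    induction hy using closure_induction with
    | mem y hy => exact hgen x hx y hy
    | one => rw [commutatorElement_one_right]; exact one_mem L
    | mul y₁ y₂ hy₁ _ ih₁ ih₂ =>
      have e : ⁅x, y₁ * y₂⁆ = ⁅x, y₁⁆ * (y₁ * ⁅x, y₂⁆ * y₁⁻¹) := by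
        simp only [commutatorElement_def]; group
      rw [e]
      exact mul_mem ih₁ (hnormL y₁ hy₁ _ ih₂)
    | inv y hy ih =>
      have e : ⁅x, y⁻¹⁆ = y⁻¹ * ⁅x, y⁆⁻¹ * y⁻¹⁻¹ := by
        simp only [commutatorElement_def]; group
      rw [e]
      exact hnormL y⁻¹ (inv_mem hy) _ (inv_mem ih)
  have hall : ∀ x ∈ closure T, ∀ y ∈ closure T, ⁅x, y⁆ ∈ L := by
    intro x hx
    induction hx using closure_induction with
    | mem x hx => exact hgen' x hx
    | one => intro y _; rw [commutatorElement_one_left]; exact one_mem L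
    | mul x₁ x₂ hx₁ _ ih₁ ih₂ =>
      intro y hy
      have e : ⁅x₁ * x₂, y⁆ = x₁ * ⁅x₂, y⁆ * x₁⁻¹ * ⁅x₁, y⁆ := by
        simp only [commutatorElement_def]; group
      rw [e]
      exact mul_mem (hnormL x₁ hx₁ _ (ih₂ y hy)) (ih₁ y hy)
    | inv x hx ih =>
      intro y hy
      have e : ⁅x⁻¹, y⁆ = x⁻¹ * ⁅x, y⁆⁻¹ * x⁻¹⁻¹ := by
        simp only [commutatorElement_def]; group
      rw [e]
      exact hnormL x⁻¹ (inv_mem hx) _ (inv_mem (ih y hy))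
  have hHL : ⁅closure T, closure T⁆ ≤ L := commutator_le.mpr hall
  -- Step 3: `L ⊓ A = 1` (`c ^ k = 1` since `α ^ (2k) = z₁ ^ k`)
  have hck : c ^ k = 1 := by
    rw [hc, hcomm.mul_pow, ← pow_mul, hαk, inv_pow, mul_inv_cancel]
  have hcm : ∀ m : ℕ, c ^ m ∈ A → c ^ m = 1 := by
    intro m hm
    have hαm : α ^ (2 * m) ∈ A := by
      rw [hc, hcomm.mul_pow, ← pow_mul] at hm
      have := mul_mem hm (pow_mem h1 m)
      rwa [inv_pow, inv_mul_cancel_right] at this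
    obtain ⟨i, hi⟩ := h3 m hαm
    rw [hi, pow_mul, hck, one_pow]
  have hzL : z ∈ L := hHL hz
  obtain ⟨n, hn⟩ := mem_zpowers_iff.mp hzL
  rcases Int.eq_nat_or_neg n with ⟨m, rfl | rfl⟩
  · rw [zpow_natCast] at hn
    rw [← hn]; exact hcm m (hn ▸ hzA)
  · rw [zpow_neg, zpow_natCast, inv_eq_iff_eq_inv] at hn
    have : c ^ m = 1 := hcm m (hn ▸ inv_mem hzA)
    rw [this] at hn
    exact (inv_eq_one.mp hn.symm)

/-! ## (C′) The extension criterion for stable characters with `e`-torsion values, index prime to `e` -/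

section ExtCrit

variable {G : Type*} [Group G] {K : Type*} [AddCommGroup K] {Q : Type*} [Group Q]

/-- **(C′) Key lemma, any torsion.** Under the dicyclic hypothesis on `Q` with `[Q : ⟨a, b⟩]` prime to `e`, a `G`-stable
additive map `ψ` on the kernel of a surjection `π : G ↠ Q`, with values in an abelian group killed by `e`, VANISHES on
`ker π ∩ [G, G]` (transfer (B′) + the dicyclic computation (A′) in `G ⧸ ker ψ`).
[cite: Brown1982CohomologyGroups, III.10 (10.1)-(10.3), IV.3 Exercise 4(a), VI.9 Exercises 3 and 8 (the Sylow / transfer argument)] -/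
theorem stable_character_eq_zero_of_mem_commutator'
    {a b : Q} {k : ℕ} (hab : b * a * b⁻¹ = a⁻¹) (hb2 : b ^ 2 = a ^ k)
    (hak : ∀ m : ℕ, a ^ (2 * m) = 1 → k ∣ m) {e : ℕ} (hidx : (closure ({a, b} : Set Q)).index.Coprime e)
    (π : G →* Q) (hπ : Function.Surjective π) (hK : ∀ y : K, e • y = 0)
    (ψ : π.ker → K) (hψ : ∀ x y : π.ker, ψ (x * y) = ψ x + ψ y)
    (hst : ∀ (g : G) (x : π.ker) (hx : g⁻¹ * (x : G) * g ∈ π.ker), ψ ⟨g⁻¹ * x * g, hx⟩ = ψ x)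
    {c : G} (hcN : c ∈ π.ker) (hc : c ∈ commutator G) : ψ ⟨c, hcN⟩ = 0 := by
  have hψ1 : ψ 1 = 0 := map_one_of_mul_add hψ
  have hψinv : ∀ x : π.ker, ψ x⁻¹ = -ψ x := map_inv_of_mul_add hψ
  have hNn : (π.ker).Normal := inferInstance
  -- the kernel of `ψ`, a normal subgroup of `G`
  let N₀ : Subgroup G :=
    { carrier := {g | ∃ h : g ∈ π.ker, ψ ⟨g, h⟩ = 0}
      mul_mem' := by
        rintro x y ⟨hx, hx0⟩ ⟨hy, hy0⟩
        refine ⟨mul_mem hx hy, ?_⟩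
        have e : (⟨x * y, mul_mem hx hy⟩ : π.ker) = ⟨x, hx⟩ * ⟨y, hy⟩ := rfl
        rw [e, hψ, hx0, hy0, add_zero]
      one_mem' := ⟨one_mem _, hψ1⟩
      inv_mem' := by
        rintro x ⟨hx, hx0⟩
        refine ⟨inv_mem hx, ?_⟩
        have e : (⟨x⁻¹, inv_mem hx⟩ : π.ker) = ⟨x, hx⟩⁻¹ := rfl
        rw [e, hψinv, hx0, neg_zero] }
  have hN₀ : ∀ g, g ∈ N₀ ↔ ∃ h : g ∈ π.ker, ψ ⟨g, h⟩ = 0 := fun g => Iff.rfl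
  have hN₀N : N₀ ≤ π.ker := fun g hg => ((hN₀ g).mp hg).1
  haveI hN₀n : N₀.Normal := by
    refine ⟨fun n hn g => ?_⟩
    obtain ⟨hn, hn0⟩ := (hN₀ n).mp hn
    have hgn : g * n * g⁻¹ ∈ π.ker := hNn.conj_mem n hn g
    refine (hN₀ _).mpr ⟨hgn, ?_⟩
    have hgn' : g⁻¹⁻¹ * n * g⁻¹ ∈ π.ker := by rw [inv_inv]; exact hgn
    have h1 : ψ ⟨g⁻¹⁻¹ * n * g⁻¹, hgn'⟩ = ψ ⟨n, hn⟩ := hst g⁻¹ ⟨n, hn⟩ hgn'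
    have e : (⟨g * n * g⁻¹, hgn⟩ : π.ker) = ⟨g⁻¹⁻¹ * n * g⁻¹, hgn'⟩ := Subtype.ext (by simp)
    rw [e, h1, hn0]
  -- the quotient `G ⧸ N₀`, in which `A = ker π / N₀` is central and killed by `e`
  set mk : G →* G ⧸ N₀ := QuotientGroup.mk' N₀ with hmk
  set A : Subgroup (G ⧸ N₀) := (π.ker).map mk with hAdef
  have hmkA : ∀ g : G, mk g ∈ A ↔ g ∈ π.ker := by
    intro g
    constructor
    · rintro ⟨n, hn, hng⟩
      obtain ⟨z, hz, rfl⟩ := (QuotientGroup.mk'_eq_mk' N₀).mp hng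
      exact mul_mem hn (hN₀N hz)
    · exact fun hg => mem_map_of_mem mk hg
  have hAc : A ≤ center (G ⧸ N₀) := by
    rintro _ ⟨n, hn, rfl⟩
    rw [mem_center_iff]
    intro v
    obtain ⟨g, rfl⟩ := QuotientGroup.mk'_surjective N₀ v
    rw [← map_mul, ← map_mul, hmk, QuotientGroup.mk'_eq_mk']
    have hgn : g⁻¹ * n * g ∈ π.ker := hNn.conj_mem' n hn g
    have hmem : (g * n)⁻¹ * (n * g) ∈ π.ker := by
      have e : (g * n)⁻¹ * (n * g) = n⁻¹ * (g⁻¹ * n * g) := by group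
      rw [e]; exact mul_mem (inv_mem hn) hgn
    refine ⟨(g * n)⁻¹ * (n * g), (hN₀ _).mpr ⟨hmem, ?_⟩, mul_inv_cancel_left _ _⟩
    have e : (⟨(g * n)⁻¹ * (n * g), hmem⟩ : π.ker) = ⟨n, hn⟩⁻¹ * ⟨g⁻¹ * n * g, hgn⟩ :=
      Subtype.ext (by simp only [Subgroup.coe_mul, Subgroup.coe_inv]; group)
    have h1 : ψ ⟨g⁻¹ * n * g, hgn⟩ = ψ ⟨n, hn⟩ := hst g ⟨n, hn⟩ hgn
    rw [e, hψ, hψinv, h1, neg_add_cancel]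
  have hAe : ∀ u ∈ A, u ^ e = 1 := by
    rintro _ ⟨n, hn, rfl⟩
    rw [← map_pow, hmk, QuotientGroup.mk'_apply, QuotientGroup.eq_one_iff]
    refine (hN₀ _).mpr ⟨pow_mem hn e, ?_⟩
    have e' : (⟨n ^ e, pow_mem hn e⟩ : π.ker) = ⟨n, hn⟩ ^ e := rfl
    rw [e', map_pow_of_mul_add hψ, hK]
  -- lifts of the dicyclic generators
  obtain ⟨α, hα⟩ := hπ a
  obtain ⟨β, hβ⟩ := hπ b
  have h1' : mk β * mk α * (mk β)⁻¹ * mk α ∈ A := by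
    rw [← map_inv, ← map_mul, ← map_mul, ← map_mul, hmkA, MonoidHom.mem_ker, map_mul, map_mul, map_mul,
      map_inv, hα, hβ, hab, inv_mul_cancel]
  have h2' : mk β ^ 2 * (mk α ^ k)⁻¹ ∈ A := by
    rw [← map_pow, ← map_pow, ← map_inv, ← map_mul, hmkA, MonoidHom.mem_ker, map_mul, map_inv, map_pow,
      map_pow, hα, hβ, hb2, mul_inv_cancel]
  have h3' : ∀ m : ℕ, mk α ^ (2 * m) ∈ A → k ∣ m := by
    intro m hm
    rw [← map_pow, hmkA, MonoidHom.mem_ker, map_pow, hα] at hm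
    exact hak m hm
  -- the subgroup `H̄ = ⟨ᾱ, β̄, A⟩` of `G ⧸ N₀`, of index prime to `e`
  set L : Subgroup G := closure ({α, β} ∪ (π.ker : Set G)) with hLdef
  have hL1 : π.ker ≤ L := fun x hx => subset_closure (Or.inr hx)
  have hL2 : L.map π = closure ({a, b} : Set Q) := by
    rw [hLdef, MonoidHom.map_closure]
    apply le_antisymm
    · refine (closure_le _).mpr ?_
      rintro _ ⟨g, hg, rfl⟩
      rcases hg with hg | hg
      · simp only [Set.mem_insert_iff, Set.mem_singleton_iff] at hg
        rcases hg with rfl | rfl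
        · rw [hα]; exact subset_closure (Set.mem_insert a {b})
        · rw [hβ]; exact subset_closure (Set.mem_insert_of_mem a rfl)
      · rw [(MonoidHom.mem_ker).mp hg]; exact one_mem _
    · refine (closure_le _).mpr ?_
      rintro x hx
      simp only [Set.mem_insert_iff, Set.mem_singleton_iff] at hx
      rcases hx with rfl | rfl
      · exact subset_closure ⟨α, Or.inl (Set.mem_insert α {β}), hα⟩
      · exact subset_closure ⟨β, Or.inl (Set.mem_insert_of_mem α rfl), hβ⟩
  have hL3 : L = (closure ({a, b} : Set Q)).comap π := by rw [← hL2, comap_map_eq_self hL1]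
  have hL4 : L.index = (closure ({a, b} : Set Q)).index := by
    rw [hL3, (closure ({a, b} : Set Q)).index_comap_of_surjective hπ]
  set H : Subgroup (G ⧸ N₀) := L.map mk with hHdef
  have hHidx : H.index.Coprime e := by
    rw [hHdef, L.index_map_eq (QuotientGroup.mk'_surjective N₀)
      (by rw [QuotientGroup.ker_mk']; exact hN₀N.trans hL1), hL4]
    exact hidx
  have hHcl : H = closure ({mk α, mk β} ∪ (A : Set (G ⧸ N₀))) := by
    rw [hHdef, hLdef, MonoidHom.map_closure, Set.image_union, Set.image_insert_eq, Set.image_singleton, hAdef, coe_map]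
  -- the transfer argument
  have hz : mk c ∈ commutator (G ⧸ N₀) := by
    have h := mem_map_of_mem mk hc
    rw [_root_.commutator_def, map_commutator] at h
    rw [_root_.commutator_def]
    exact commutator_mono le_top le_top h
  have hzA : mk c ∈ A := (hmkA c).mpr hcN
  have hz2 : mk c ∈ ⁅H, H⁆ := mem_commutator_subgroup_of_coprime_index hHidx (hAc hzA) (hAe _ hzA) hz
  rw [hHcl] at hz2
  have hone : mk c = 1 := eq_one_of_mem_commutator_closure_dicyclic' A hAc h1' h2' h3' hzA hz2
  rw [hmk, QuotientGroup.mk'_apply, QuotientGroup.eq_one_iff] at hone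
  obtain ⟨h, h0⟩ := (hN₀ c).mp hone
  exact h0

/-- **Uniqueness half, any torsion.** Two additive maps `G → K` agreeing on `ker π` are equal when `Q` is generated by
elements killed by `q` and `q` acts invertibly on `K` (`(q u) • y = y`): `Hom(Q, K) = 0`.
[cite: Brown1982CohomologyGroups, III.1 Exercise 2 (H^1 = Hom for trivial coefficients; shape only)] -/
theorem eq_of_mul_add_of_eqOn_ker' {q u : ℕ} {S : Set Q} (hS : closure S = ⊤)
    (hSq : ∀ s ∈ S, s ^ q = 1) (π : G →* Q) (hπ : Function.Surjective π) (hu : ∀ y : K, (q * u) • y = y)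
    {Ψ₁ Ψ₂ : G → K} (h₁ : ∀ x y, Ψ₁ (x * y) = Ψ₁ x + Ψ₁ y) (h₂ : ∀ x y, Ψ₂ (x * y) = Ψ₂ x + Ψ₂ y)
    (h : ∀ x ∈ π.ker, Ψ₁ x = Ψ₂ x) : Ψ₁ = Ψ₂ := by
  set δ : G → K := fun g => Ψ₁ g - Ψ₂ g with hδ
  have hδa : ∀ x y, δ (x * y) = δ x + δ y := by intro x y; simp only [hδ, h₁, h₂]; abel
  have hδN : ∀ x ∈ π.ker, δ x = 0 := fun x hx => by simp only [hδ, h x hx, sub_self]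
  suffices hmain : ∀ x : Q, ∀ g : G, π g = x → δ g = 0 by
    funext g
    exact sub_eq_zero.mp (hmain (π g) g rfl)
  intro x
  have hx : x ∈ closure S := by rw [hS]; exact mem_top x
  induction hx using closure_induction with
  | mem s hs =>
    intro g hg
    have hgq : g ^ q ∈ π.ker := by rw [MonoidHom.mem_ker, map_pow, hg, hSq s hs]
    have h0 : δ (g ^ q) = 0 := hδN _ hgq
    rw [map_pow_of_mul_add hδa] at h0
    rw [← hu (δ g), mul_nsmul, h0, nsmul_zero]
  | one => intro g hg; exact hδN g (by rwa [MonoidHom.mem_ker])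
  | mul x y _ _ ihx ihy =>
    intro g hg
    obtain ⟨g₁, hg₁⟩ := hπ x
    have hg₂ : π (g₁⁻¹ * g) = y := by rw [map_mul, map_inv, hg₁, hg, inv_mul_cancel_left]
    rw [← mul_inv_cancel_left g₁ g, hδa, ihx g₁ hg₁, ihy _ hg₂, add_zero]
  | inv x _ ih =>
    intro g hg
    have hg' : π g⁻¹ = x := by rw [map_inv, hg, inv_inv]
    have := ih g⁻¹ hg'
    rwa [map_inv_of_mul_add hδa, neg_eq_zero] at this

/-- **Abstract extension criterion, any torsion (EXT-CRIT for a group with a dicyclic subgroup of index prime to `e`).**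
Let `Q` be a group generated by a set `S` of elements killed by `q`, containing elements `a, b` with the DICYCLIC
relations `b a b⁻¹ = a⁻¹`, `b² = a^k`, `a^{2m} = 1 ⇒ k ∣ m` (no parity condition on `k`), such that `⟨a, b⟩` has index
prime to `e`.  Then for every surjection `π : G ↠ Q`, every abelian group `K` with `e • y = 0` on which `q` acts
invertibly (`(q u) • y = y`), and every `G`-stable additive `ψ : ker π → K` there is a UNIQUE additive `Ψ : G → K` with
`Ψ|_{ker π} = ψ` (existence: `Ψ(g) = u • ψ(n)` for `g^q = n·c`, `c ∈ [G, G]`, well defined by (C′)).  The sibling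
`CentralExtensionDicyclic.existsUnique_extension_of_stable_of_dicyclic_oddIndex` is the case `e = 2`, `q` odd.
[cite: Brown1982CohomologyGroups, III.10 (10.1)-(10.3), IV.3 Exercise 4(a), VI.9 Exercises 3 and 8; Gorenstein1982, Prop. 4.232 (i) (p. 288) (M(SL_2(p)) = 1: the statement this abstract form serves at e = 3)] -/
theorem existsUnique_extension_of_stable_of_dicyclic_coprimeIndex
    {q u e : ℕ} {S : Set Q} (hS : closure S = ⊤) (hSq : ∀ s ∈ S, s ^ q = 1)
    {a b : Q} {k : ℕ} (hab : b * a * b⁻¹ = a⁻¹) (hb2 : b ^ 2 = a ^ k)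
    (hak : ∀ m : ℕ, a ^ (2 * m) = 1 → k ∣ m) (hidx : (closure ({a, b} : Set Q)).index.Coprime e)
    (π : G →* Q) (hπ : Function.Surjective π) (hK : ∀ y : K, e • y = 0) (hu : ∀ y : K, (q * u) • y = y)
    (ψ : π.ker → K) (hψ : ∀ x y : π.ker, ψ (x * y) = ψ x + ψ y)
    (hst : ∀ (g : G) (x : π.ker) (hx : g⁻¹ * (x : G) * g ∈ π.ker), ψ ⟨g⁻¹ * x * g, hx⟩ = ψ x) :
    ∃! Ψ : G → K, (∀ x y : G, Ψ (x * y) = Ψ x + Ψ y) ∧ ∀ x : π.ker, Ψ x = ψ x := by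
  have hψinv : ∀ x : π.ker, ψ x⁻¹ = -ψ x := map_inv_of_mul_add hψ
  -- vanishing on `ker π ∩ [G, G]`
  have hvan : ∀ (c : G) (hcN : c ∈ π.ker), c ∈ commutator G → ψ ⟨c, hcN⟩ = 0 := fun c hcN hc =>
    stable_character_eq_zero_of_mem_commutator' hab hb2 hak hidx π hπ hK ψ hψ hst hcN hc
  -- well-definedness: `n₁ c₁ = n₂ c₂` with `nᵢ ∈ ker π`, `cᵢ ∈ [G, G]` forces `ψ n₁ = ψ n₂`
  have hwd : ∀ (n₁ n₂ c₁ c₂ : G) (h₁ : n₁ ∈ π.ker) (h₂ : n₂ ∈ π.ker), c₁ ∈ commutator G → c₂ ∈ commutator G →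
      n₁ * c₁ = n₂ * c₂ → ψ ⟨n₁, h₁⟩ = ψ ⟨n₂, h₂⟩ := by
    intro n₁ n₂ c₁ c₂ h₁ h₂ hc₁ hc₂ h
    have e : n₂⁻¹ * n₁ = c₂ * c₁⁻¹ := by rw [eq_mul_inv_of_mul_eq h]; group
    have hmem : n₂⁻¹ * n₁ ∈ commutator G := by rw [e]; exact mul_mem hc₂ (inv_mem hc₁)
    have h0 := hvan (n₂⁻¹ * n₁) (mul_mem (inv_mem h₂) h₁) hmem
    have e' : (⟨n₂⁻¹ * n₁, mul_mem (inv_mem h₂) h₁⟩ : π.ker) = ⟨n₂, h₂⟩⁻¹ * ⟨n₁, h₁⟩ := rfl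
    rw [e', hψ, hψinv, neg_add_eq_zero] at h0
    exact h0.symm
  -- `q`-th powers of `G` land in `ker π · [G, G]`
  have hdec : ∀ g : G, ∃ c ∈ commutator G, g ^ q * c⁻¹ ∈ π.ker := by
    intro g
    have h : π g ^ q ∈ (commutator G).map π := by
      rw [_root_.commutator_def, map_commutator, ← MonoidHom.range_eq_map, MonoidHom.range_eq_top.mpr hπ,
        ← _root_.commutator_def]
      exact pow_mem_commutator_of_closure hS hSq (π g)
    obtain ⟨c, hc, hπc⟩ := h
    exact ⟨c, hc, by rw [MonoidHom.mem_ker, map_mul, map_inv, map_pow, ← hπc, mul_inv_cancel]⟩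
  choose cf hcf hker using hdec
  have hofc : ∀ g : G, Abelianization.of (cf g) = 1 := fun g => (mem_commutator_iff_of_eq_one _).mp (hcf g)
  have hofn : ∀ g : G, Abelianization.of (g ^ q * (cf g)⁻¹) = Abelianization.of g ^ q := by
    intro g; rw [map_mul, map_inv, map_pow, hofc, inv_one, mul_one]
  set Ψ : G → K := fun g => u • ψ ⟨g ^ q * (cf g)⁻¹, hker g⟩ with hΨdef
  have hadd : ∀ g h : G, Ψ (g * h) = Ψ g + Ψ h := by
    intro g h
    have e : (⟨g ^ q * (cf g)⁻¹, hker g⟩ : π.ker) * ⟨h ^ q * (cf h)⁻¹, hker h⟩ =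
        ⟨g ^ q * (cf g)⁻¹ * (h ^ q * (cf h)⁻¹), mul_mem (hker g) (hker h)⟩ := rfl
    simp only [hΨdef]
    rw [← nsmul_add, ← hψ, e]
    congr 1
    refine hwd _ _ (cf (g * h)) ((g ^ q * (cf g)⁻¹ * (h ^ q * (cf h)⁻¹))⁻¹ * (g * h) ^ q) _ _ (hcf _) ?_ ?_
    · rw [mem_commutator_iff_of_eq_one, map_mul, map_inv, map_mul, hofn, hofn, map_pow, map_mul, mul_pow,
        inv_mul_cancel]
    · rw [inv_mul_cancel_right, mul_inv_cancel_left]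
  have hext : ∀ x : π.ker, Ψ x = ψ x := by
    rintro ⟨x, hx⟩
    have e1 : ψ ⟨(x : G) ^ q * (cf x)⁻¹, hker x⟩ = ψ ⟨x ^ q, pow_mem hx q⟩ :=
      hwd _ _ (cf x) 1 _ _ (hcf x) (one_mem _) (by rw [inv_mul_cancel_right, mul_one])
    have e2 : (⟨x ^ q, pow_mem hx q⟩ : π.ker) = ⟨x, hx⟩ ^ q := rfl
    show u • ψ ⟨x ^ q * (cf x)⁻¹, hker x⟩ = ψ ⟨x, hx⟩
    rw [e1, e2, map_pow_of_mul_add hψ, ← mul_nsmul, hu]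
  refine ⟨Ψ, ⟨hadd, hext⟩, fun Ψ₁ hΨ₁ => ?_⟩
  exact eq_of_mul_add_of_eqOn_ker' hS hSq π hπ hu hΨ₁.1 hadd
    (fun x hx => (hΨ₁.2 ⟨x, hx⟩).trans (hext ⟨x, hx⟩).symm)

/-- `q` acts invertibly on an abelian group killed by `e` when `q` is prime to `e` (the witness `u` for
`existsUnique_extension_of_stable_of_dicyclic_coprimeIndex`; plumbing).
[cite: Brown1982CohomologyGroups, III.10 (10.1) (multiplication by an integer prime to the exponent is invertible on the coefficient module; shape only)] -/
theorem exists_mul_nsmul_eq_self_of_coprime {q e : ℕ} (hq : q.Coprime e) (hK : ∀ y : K, e • y = 0) :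
    ∃ u : ℕ, ∀ y : K, (q * u) • y = y := by
  rcases Nat.lt_or_ge 1 e with he | he
  · obtain ⟨u, -, hu⟩ := Nat.exists_mul_mod_eq_one_of_coprime hq he
    refine ⟨u, fun y => ?_⟩
    conv_lhs => rw [← Nat.div_add_mod (q * u) e, hu]
    rw [add_nsmul, one_nsmul, mul_nsmul, hK, nsmul_zero, zero_add]
  · interval_cases e
    · rw [Nat.coprime_zero_right] at hq
      exact ⟨1, fun y => by rw [hq, one_mul, one_nsmul]⟩
    · exact ⟨0, fun y => by have := hK y; rw [one_nsmul] at this; rw [this, nsmul_zero]⟩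

end ExtCrit

end Literature.GroupTheory.CentralExtensionDicyclicTorsion
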